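import Summits.ResolutionOfSingularities.ResolutionOfSingularities.Theorems.ThreadCutPinf
import Summits.ResolutionOfSingularities.ResolutionOfSingularities.Theorems.NoJump
import Mathlib.Algebra.MvPolynomial.Division
import Literature.AlgebraicGeometry.Resolution.WeightedBlowupNoIncrease
import HarnessLib

/-!
# BandCutLaw — decomp-res node «BandCut» (lens-5 g33, critic row 205 BOOKED 0 (law banked by name); optional landing
rider INBOX 2026-08-31T09:55:54Z), tree file 1/3 of the node

Content VERBATIM from the decomp-res lens-5 g33 node «BandCut», LANDING SHAPE prepared by the lens itself: `HOME/decomp-res-lens-5/g33/landing/BandCutLaw.lean` (sha256 6d3d9ad4, 340 l = header + §1–§3) and `landing/BandCutThreads.lean` (sha256 651016ec, 408 l = §4–§5) of the node `HOME/decomp-res-lens-5/g33/BandCut.lean` (818612f8, 714 l; NODE-g33.md f80bda18 §7; bc/Probe.lean 3d664d21 HOME-only); shas verified = NODE/PIN STATUS 2026-08-31T09:47:52Z and CRITIC-LEDGER row 205; HOME = run/shared/lean/pub/decomp-res.  Imports the LANDED tree only (`ThreadCutPinf` ⊇ `ThreadCutLaw*` = g31 «ThreadCut», `NoJump` = g14);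 no carry; namespace `…Theorems.BandCut` with `_root_.…TightDefectClasses.ForcedWalk.*` / `_root_.…ThreadCut.Thread.*` corollaries placed in the objects' own namespaces, exactly as in the node; every declaration is new (writer tree check: no `ForcedWalk.ordZero_le_two_mul_sub_two` / `.band` / `.shade_add_degree_le` / `.degree_le_of_shade_eq` / `.ordZero_eq_two`, no `Thread.OutOfBandIO` / `.nonIsolatedIO_of_outOfBandIO`, no `BandCut.*` in the tree before this node; the gate's pre-flight dedup run clean).  Farm (node; lens + critic runs): rc 0 · 0 err · 0 warn · 0 sorry; std axioms on `BandCut.not_isolatedTop_step_of_le_ordZero`, `TightDefectClasses.ForcedWalk.ordZero_le_two_mul_sub_two`, `ThreadCut.Thread.nonIsolatedIO_of_outOfBandIO`, `BandCut.translating_kinds_inhabited`; Probe rc 0 · 3/3 sorry (P1 = 31770 untouched).  Critic: CRITIC-LEDGER row 205 «BandCut» — verdict BOOKED 0 («BandCut» alone was PRE-PRICED 0, STATUS 2026-08-31T09:39:22Z: the thread axis is a clock; the node is exactly the pre-priced object — layer law + walk band + thread kinds by order band + glider inhabitants; honest throughout, nothing claimed) WITH THE LAW BANKED BY NAME for later credit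 inside (T-tr) WHOLE / (T-bridge) / the MAP tower-dictionary port: `BandCut.not_isolatedTop_step_of_le_ordZero` (THE LAW: `2 ≤ q`, `b_j = 0`, `2q − 1 ≤ ord₀ s.F`, equimultiple ⇒ `¬ IsolatedTop q (step q j b s).F` — any field, corner or translating, hypothesis-free), `ForcedWalk.ordZero_le_two_mul_sub_two` (THE WALK BAND `ord₀ F_t ≤ 2q − 2` for every `t`; + `.band` / `.shade_add_degree_le` / `.degree_le_of_shade_eq` / `.ordZero_eq_two`), `Thread.nonIsolatedIO_of_outOfBandIO`, `BandCut.not_isolatedTop_of_le_span_pair`, the gliders.  Landing = the critic's OPTIONAL LOW-PRIORITY rider to the writer (INBOX 2026-08-31T09:55:54Z, «0-weight; after rows 202–204»): `Theorems/BandCutLaw` := landing/BandCutLaw.lean, then `Theorems/BandCutThreads` := landing/BandCutThreads.lean, both `--kind proof --supports stmt-ResolutionOfSingularities-31770`, dry-run first, no aside change.  The `def … : Prop` declarations (`ThreadCut.Thread.OutOfBandIO`, `ThreadCut.Thread.EventuallyInBand`, `ThreadCut.Thread.NonIsolatedIO`) are THIS node's thread-kind predicates — none is a vendored fact.  Nothing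 here is progress on `ResolutionOfSingularities` (rung 0): the column item 31770 `DefectWalksTerminateDeep` is untouched; the node decides sub-kinds of the thread axis and certifies inhabitants.

## This file

§1 TWO GENERATORS THROUGH THE ORIGIN NEVER ISOLATE IT (`section TwoGenerators`; elementary, `Fin 3`, any field):
`dvd_of_dvd_mul_X_pow`, **`not_isolatedTop_of_le_span_pair`**; §2 THE LAYER LEMMA AND THE LAW (`section Law`):
`le_apply_of_mem_support_step` (layers), `topIdeal_le_span_pair_of_layer`, `coeff_single_step_eq_zero`,
**`not_isolatedTop_step_of_le_ordZero`** (`2q − 1 ≤ ord₀ s.F`, `b_j = 0`, equimultiple ⇒ the successor is not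
isolated — corner OR translating); §3 THE WALK BAND (`section Walk`; hypothesis-free, any `q ≥ 2`):
**`ForcedWalk.ordZero_le_two_mul_sub_two`** (`ord₀ F_t ≤ 2q − 2` for every `t`), `ForcedWalk.band`,
`ForcedWalk.excess_le`, the ledger currency `ForcedWalk.shade_add_degree_le` / `ForcedWalk.degree_le_of_shade_eq`,
`ForcedWalk.ordZero_eq_two` (`q = 2`).

[WRITER NOTE (decomp-res writer g13): `BandCutLaw` = landing file 1/2 verbatim (one tree file; its 48-line landing
header is reproduced verbatim in `BandCutThreads` — no room for it here next to the provenance under the 400-line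
cap); landing file 2/2 is 408 lines, over the tree's 400-line cap, and is cut at the node's own section boundary:
`BandCutThreads` = §4 (`section Threads`), `BandCutThreads2` = §5 (`section Glider`); the file-level `noncomputable
section` and `open` lines are replayed in each part; sections, section variables (incl. the `variable (K …)` /
`variable {K}` binder switch of §5) and every declaration exactly as in the landing files; `[cite: …]` groups in
docstrings are rendered `(Sources: …)` (tree lint).  No dedup deletions (pre-flight clean).]

(Sources: Hauser2010 §§F–G; HauserPerlega2019PRIMS §3; Giraud1975 §1; BierstoneGrigorievMilmanWlodarczyk2011 Def. 3.1.3.)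
-/

noncomputable section

open MvPolynomial
open Literature.AlgebraicGeometry.Resolution
open Literature.AlgebraicGeometry.Resolution.Hauser2010
open Literature.AlgebraicGeometry.Resolution.PointBlowup
open Summit.ResolutionOfSingularities.ResolutionOfSingularities.Theorems.TightDefectClasses
open Summit.ResolutionOfSingularities.ResolutionOfSingularities.Theorems.ItineraryCutClasses
open Summit.ResolutionOfSingularities.ResolutionOfSingularities.Theorems.LassoCut
open Summit.ResolutionOfSingularities.ResolutionOfSingularities.Theorems.ThreadCut

namespace Summit.ResolutionOfSingularities.ResolutionOfSingularities.Theorems.BandCut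

section TwoGenerators

variable {K : Type} [Field K]

/-! ## §1 Two generators through the origin never isolate it (elementary, `Fin 3`, any field) -/

/-- Killing the variable `u_j` (`u_j ↦ 0`, the other variables fixed). DEFINITION (support). -/
def killVar (j : Fin 3) : MvPolynomial (Fin 3) K →ₐ[K] MvPolynomial (Fin 3) K :=
  aeval fun l => if l = j then 0 else X l

/-- `u_j ↦ 0`. [folklore] -/
@[simp] theorem killVar_X_self (j : Fin 3) : killVar j (X j : MvPolynomial (Fin 3) K) = 0 := by
  simp [killVar]

/-- `u_l ↦ u_l` for `l ≠ j`. [folklore] -/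
@[simp] theorem killVar_X_of_ne {j l : Fin 3} (h : l ≠ j) : killVar j (X l : MvPolynomial (Fin 3) K) = X l := by
  simp [killVar, h]

/-- Killing a variable does not change the constant coefficient. [folklore] -/
theorem constantCoeff_killVar (j : Fin 3) (g : MvPolynomial (Fin 3) K) :
    constantCoeff (killVar j g) = constantCoeff g := by
  have h : constantCoeff.comp (killVar (K := K) j).toRingHom = constantCoeff := by
    refine MvPolynomial.ringHom_ext (fun a => ?_) (fun l => ?_)
    · simp [killVar]
    · by_cases hl : l = j
      · subst hl; simp
      · simp [hl]
  exact RingHom.congr_fun h g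

/-- **`G ∣ h·u_i^N` and `G ∣ h·u_k^N` for two DIFFERENT variables force `G ∣ h`** (`u_i` is prime and does not divide
`u_k`; cancellation in the domain `K[u]`). [folklore] -/
theorem dvd_of_dvd_mul_X_pow {G h : MvPolynomial (Fin 3) K} {i k : Fin 3} (hik : i ≠ k) {N : ℕ}
    (hi : G ∣ h * X i ^ N) (hk : G ∣ h * X k ^ N) : G ∣ h := by
  by_cases hG : G = 0
  · subst hG
    rw [zero_dvd_iff] at hi ⊢
    exact (mul_eq_zero.mp hi).resolve_right (pow_ne_zero _ (X_ne_zero i))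
  obtain ⟨A, hA⟩ := hi
  obtain ⟨B, hB⟩ := hk
  have hAB : A * X k ^ N = B * X i ^ N := by
    apply mul_left_cancel₀ hG
    calc G * (A * X k ^ N) = (G * A) * X k ^ N := by ring
      _ = h * X i ^ N * X k ^ N := by rw [← hA]
      _ = h * X k ^ N * X i ^ N := by ring
      _ = G * B * X i ^ N := by rw [← hB]
      _ = G * (B * X i ^ N) := by ring
  have hXi : (X i : MvPolynomial (Fin 3) K) ^ N ∣ A := by
    have hdvd : (X i : MvPolynomial (Fin 3) K) ^ N ∣ A * X k ^ N := ⟨B, by rw [hAB]; ring⟩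
    refine (X_prime (i := i)).pow_dvd_of_dvd_mul_right N ?_ hdvd
    intro h'
    have := (X_prime (R := K) (i := i)).dvd_of_dvd_pow h'
    rw [X_dvd_X] at this
    exact hik this
  obtain ⟨A', rfl⟩ := hXi
  refine ⟨A', mul_right_cancel₀ (pow_ne_zero N (X_ne_zero i)) ?_⟩
  rw [hA]; ring

/-- **TWO GENERATORS NEVER ISOLATE**: if the top ideal of `P` lies in `(u_j, G)` with `G(0) = 0`, the origin is NOT an isolated
top point of `P` (kill `u_j`: an isolation witness `g`, `g(0) ≠ 0`, would give `Ḡ ∣ ḡ·u_i^N`, `Ḡ ∣ ḡ·u_k^N` for the two other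
variables, hence `Ḡ ∣ ḡ` and `0 = Ḡ(0) ∣ ḡ(0) = g(0)`).  Geometrically: `Top(P) ⊇ {u_j = 0, G = 0}`, a curve through the
origin. [new] [folklore] -/
theorem not_isolatedTop_of_le_span_pair {q : ℕ} {P G : MvPolynomial (Fin 3) K} (j : Fin 3)
    (hJ : topIdeal q P ≤ Ideal.span {X j, G}) (hG : constantCoeff G = 0) : ¬ IsolatedTop q P := by
  classical
  rintro ⟨N, g, hg0, hg⟩
  -- the two other variables
  obtain ⟨i, hi⟩ : ∃ i : Fin 3, i ≠ j := exists_ne j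
  have aux : ∀ i j : Fin 3, i ≠ j → ∃ k : Fin 3, k ≠ j ∧ k ≠ i := by decide
  obtain ⟨k, hk, hki⟩ := aux i j hi
  have key : ∀ l : Fin 3, l ≠ j → killVar j G ∣ killVar j g * X l ^ N := by
    intro l hl
    have hmem := hJ (hg l)
    rw [Ideal.mem_span_pair] at hmem
    obtain ⟨a, c, hac⟩ := hmem
    refine ⟨killVar j c, ?_⟩
    have := congrArg (killVar (K := K) j) hac
    simp only [map_add, map_mul, map_pow, killVar_X_self, killVar_X_of_ne hl, mul_zero, zero_add] at this
    rw [← this]; ring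
  have hdvd := dvd_of_dvd_mul_X_pow hki.symm (key i hi) (key k hk)
  have h0 : constantCoeff (killVar j G) ∣ constantCoeff (killVar j g) := map_dvd constantCoeff hdvd
  rw [constantCoeff_killVar, constantCoeff_killVar, hG, zero_dvd_iff] at h0
  exact hg0 h0

end TwoGenerators

section Law

variable {K : Type} [Field K] [DecidableEq K] {q : ℕ}

/-! ## §2 The layer lemma and THE LAW: the top excess layer has no isolated successor -/

omit [DecidableEq K] in
/-- The monomials of a polynomial of order `≥ n` have degree `≥ n`. [folklore] -/
theorem le_degree_of_mem_support_of_le_ordZero {n : ℕ} {F : MvPolynomial (Fin 3) K} (hF : (n : ℕ∞) ≤ ordZero F)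
    {d : Fin 3 →₀ ℕ} (hd : d ∈ F.support) : n ≤ d.degree := by
  by_contra h
  exact (MvPolynomial.mem_support_iff.mp hd) ((natCast_le_ordZero_iff_forall_coeff F n).mp hF d (not_le.mp h))

/-- **THE LAYERS OF A SUCCESSOR**: if `ord₀ F ≥ n ≥ q` then every monomial `u^m` of `(step q j b s).F` (`b_j = 0`) has
`m_j ≥ n − q` (chart law `m_j = |d| − q`; translation with `b_j = 0` and cleaning do not touch the `u_j`-exponent).
[folklore] -/
theorem le_apply_of_mem_support_step {n : ℕ} (j : Fin 3) {b : Fin 3 → K} (hbj : b j = 0) (s : State (Fin 3) K)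
    (hn : (n : ℕ∞) ≤ ordZero s.F) (hq : q ≤ n) {m : Fin 3 →₀ ℕ} (hm : m ∈ (step q j b s).F.support) : n - q ≤ m j := by
  classical
  have hall : ∀ d ∈ s.F.support, q ≤ d.degree := fun d hd => le_trans hq (le_degree_of_mem_support_of_le_ordZero hn hd)
  -- cleaning only deletes monomials
  have hm1 : m ∈ (translate b (chartTransform q j s.F)).support := by
    rw [MvPolynomial.mem_support_iff] at hm ⊢
    change coeff m (deletePthPowers q (translate b (chartTransform q j s.F))) ≠ 0 at hm
    rw [coeff_deletePthPowers] at hm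
    split_ifs at hm with h
    · exact (hm rfl).elim
    · exact hm
  -- translation with `b_j = 0` keeps the `u_j`-exponent
  rw [MvPolynomial.mem_support_iff, PointBlowup.translate_eq_sum_support, coeff_sum] at hm1
  obtain ⟨E, hE, hne⟩ := Finset.exists_ne_zero_of_sum_ne_zero hm1
  have hmE : m j = E j := PointBlowup.apply_eq_of_coeff_translate_monomial_ne_zero b hbj hne
  -- chart law
  rw [HauserPerlega2024.support_chartTransform q j hall, Finset.mem_image] at hE
  obtain ⟨d, hd, rfl⟩ := hE
  rw [hmE, chartExponent_apply, if_pos rfl]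
  have := le_degree_of_mem_support_of_le_ordZero hn hd
  omega

omit [DecidableEq K] in
/-- Hasse derivatives BELOW the layer stay in `(u_j)`: if every monomial of `P` has `u_j`-exponent `≥ n` and `α_j < n`,
every monomial of `D^{(α)}P` keeps a positive `u_j`-exponent. [folklore] (Sources: Giraud1975, §1 (Hasse–Schmidt
derivations).) -/
theorem hasseDeriv_mem_span_X_of_layer (j : Fin 3) {P : MvPolynomial (Fin 3) K} {n : ℕ} (hP : ∀ m ∈ P.support, n ≤ m j)
    {α : Fin 3 →₀ ℕ} (hα : α j < n) :
    hasseDeriv K α P ∈ Ideal.span (MvPolynomial.X '' ({j} : Set (Fin 3)) : Set (MvPolynomial (Fin 3) K)) := by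
  classical
  rw [MvPolynomial.mem_ideal_span_X_image]
  intro m hm
  rw [MvPolynomial.mem_support_iff, coeff_hasseDeriv_eq] at hm
  have hαm : coeff (α + m) P ≠ 0 := fun h => hm (by rw [h, mul_zero])
  have h1 := hP _ (MvPolynomial.mem_support_iff.mpr hαm)
  rw [Finsupp.add_apply] at h1
  exact ⟨j, Set.mem_singleton j, by omega⟩

omit [DecidableEq K] in
/-- **THE LAYER LEMMA**: if every monomial of `P` has `u_j`-exponent `≥ q − 1`, then the top ideal
`J_P = (D^{(d)}P : 0 < |d| < q)` lies in `(u_j, D^{((q−1)·e_j)}P)` — every OTHER Hasse derivative of order `< q` has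
`d_j ≤ q − 2` and lands in `(u_j)`. [new] [folklore] -/
theorem topIdeal_le_span_pair_of_layer (j : Fin 3) {P : MvPolynomial (Fin 3) K} (hP : ∀ m ∈ P.support, q - 1 ≤ m j) :
    topIdeal q P ≤ Ideal.span {X j, hasseDeriv K (Finsupp.single j (q - 1)) P} := by
  classical
  refine Ideal.span_le.mpr ?_
  rintro _ ⟨α, ⟨hα0, hαq⟩, rfl⟩
  by_cases hα : α = Finsupp.single j (q - 1)
  · subst hα
    exact Ideal.subset_span (Set.mem_insert_of_mem _ rfl)
  · have hdeg := degree_eq_add_sum_erase j α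
    have hαj : α j < q - 1 := by
      by_contra h2
      apply hα
      have hαj' : α j = q - 1 := by omega
      have hsum : ∑ x ∈ Finset.univ.erase j, α x = 0 := by omega
      ext l
      by_cases hl : l = j
      · subst hl; rw [Finsupp.single_eq_same, hαj']
      · rw [Finsupp.single_apply, if_neg (show j ≠ l from Ne.symm hl)]
        exact Finset.sum_eq_zero_iff.mp hsum l (Finset.mem_erase.mpr ⟨hl, Finset.mem_univ l⟩)
    have hmem := hasseDeriv_mem_span_X_of_layer j hP hαj
    rw [Set.image_singleton] at hmem
    exact Ideal.span_mono (Set.singleton_subset_iff.mpr (Set.mem_insert _ _)) hmem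

/-- After an EQUIMULTIPLE step the coefficient of `u_j^{q−1}` vanishes (a monomial of degree `q − 1 < q` of the point
transform; cleaning does not touch it). [folklore] -/
theorem coeff_single_step_eq_zero (hq : 2 ≤ q) (j : Fin 3) (b : Fin 3 → K) (s : State (Fin 3) K)
    (heq : IsEquimultiplePoint q j b s) : coeff (Finsupp.single j (q - 1)) (step q j b s).F = 0 := by
  classical
  change coeff (Finsupp.single j (q - 1)) (deletePthPowers q (pointTransform q j b s)) = 0
  rw [coeff_deletePthPowers]
  split_ifs with h
  · rfl
  · refine heq _ (Finsupp.single_ne_zero.mpr (by omega)) ?_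
    rw [Finsupp.degree_single]
    omega

/-- **THE LAW — the top excess layer has no isolated successor** (any field, any `q ≥ 2`, corner OR translating point, no
root / cleanness / characteristic hypothesis): if `ord₀ s.F ≥ 2q − 1` and `b` (`b_j = 0`) is an equimultiple point of the
chart `u_j`, the origin of `(step q j b s).F` is NOT an isolated top point — `Top ⊇ {u_j = 0, G₀ = 0}`, the tangent cone's
trace on `E`. [new] [folklore] -/
theorem not_isolatedTop_step_of_le_ordZero (hq : 2 ≤ q) (j : Fin 3) {b : Fin 3 → K} (hbj : b j = 0)
    (s : State (Fin 3) K) (ho : ((2 * q - 1 : ℕ) : ℕ∞) ≤ ordZero s.F) (heq : IsEquimultiplePoint q j b s) :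
    ¬ IsolatedTop q (step q j b s).F := by
  classical
  have hlayer : ∀ m ∈ (step q j b s).F.support, q - 1 ≤ m j := fun m hm => by
    have := le_apply_of_mem_support_step j hbj s ho (by omega) hm
    omega
  refine not_isolatedTop_of_le_span_pair j (topIdeal_le_span_pair_of_layer j hlayer) ?_
  change coeff 0 (hasseDeriv K (Finsupp.single j (q - 1)) (step q j b s).F) = 0
  rw [coeff_hasseDeriv_eq, add_zero, coeff_single_step_eq_zero hq j b s heq, mul_zero]

/-- Contrapositive, the form the walks use: an ISOLATED successor forces `ord₀ F ≤ 2q − 2`. [new] [folklore] -/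
theorem ordZero_le_of_isolatedTop_step (hq : 2 ≤ q) (j : Fin 3) {b : Fin 3 → K} (hbj : b j = 0)
    (s : State (Fin 3) K) (heq : IsEquimultiplePoint q j b s) (hiso : IsolatedTop q (step q j b s).F) :
    ordZero s.F ≤ ((2 * q - 2 : ℕ) : ℕ∞) := by
  by_contra h
  refine not_isolatedTop_step_of_le_ordZero hq j hbj s ?_ heq hiso
  rw [not_le] at h
  have h1 := Order.add_one_le_of_lt h
  have h2 : ((2 * q - 2 : ℕ) : ℕ∞) + 1 = ((2 * q - 1 : ℕ) : ℕ∞) := by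
    rw [show 2 * q - 1 = (2 * q - 2) + 1 by omega, Nat.cast_add, Nat.cast_one]
  rwa [h2] at h1

end Law

section Walk

variable {K : Type} [Field K] [DecidableEq K] {q : ℕ} {s₀ : State (Fin 3) K}

/-! ## §3 THE WALK BAND `q ≤ ord₀ F_t ≤ 2q − 2` (hypothesis-free) -/

/-- **THE BAND LAW FOR FORCED WALKS** (ANY field, ANY `q ≥ 2`, no root hypothesis): along every forced walk
`ord₀ F_t ≤ 2q − 2` for EVERY `t` — the isolation binder at stage `t + 1` and §2.  Sharpens `NoJump.order_lt_two_mul`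
(`ord₀ F_t < 2q`): the KIND «visits the top excess layer `E_t = q − 1`» is EMPTY for forced walks. [new] [folklore] -/
theorem _root_.Summit.ResolutionOfSingularities.ResolutionOfSingularities.Theorems.TightDefectClasses.ForcedWalk.ordZero_le_two_mul_sub_two
    (hq : 2 ≤ q) (W : ForcedWalk q s₀) (t : ℕ) : ordZero (W.st t).F ≤ ((2 * q - 2 : ℕ) : ℕ∞) := by
  refine ordZero_le_of_isolatedTop_step hq (W.j t) (W.onExc t) (W.st t) (W.equimult t) ?_
  rw [← W.st_succ t]
  exact W.isolated (t + 1)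

/-- **THE BAND** with a root: `q ≤ ord₀ F_t ≤ 2q − 2` at every stage of every forced walk from a root. [new] [folklore] -/
theorem _root_.Summit.ResolutionOfSingularities.ResolutionOfSingularities.Theorems.TightDefectClasses.ForcedWalk.band
    (hq : 2 ≤ q) (hroot : IsRoot q s₀) (W : ForcedWalk q s₀) (t : ℕ) :
    ∃ o : ℕ, ordZero (W.st t).F = o ∧ q ≤ o ∧ o ≤ 2 * q - 2 := by
  obtain ⟨o, ho, hqo⟩ := walk_nat hroot W t
  refine ⟨o, ho, hqo, ?_⟩
  have := W.ordZero_le_two_mul_sub_two hq t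
  rw [ho] at this
  exact_mod_cast this

/-- In excess terms: `E_t = ord₀ F_t − q ≤ q − 2` (the top excess layer `q − 1` allowed by `NoJump` never occurs).
[new] [folklore] -/
theorem _root_.Summit.ResolutionOfSingularities.ResolutionOfSingularities.Theorems.TightDefectClasses.ForcedWalk.excess_le
    (hq : 2 ≤ q) (hroot : IsRoot q s₀) (W : ForcedWalk q s₀) (t : ℕ) :
    ∃ o : ℕ, ordZero (W.st t).F = o ∧ o - q ≤ q - 2 := by
  obtain ⟨o, ho, -, h⟩ := W.band hq hroot t
  exact ⟨o, ho, by omega⟩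

/-- **THE BAND IN LEDGER CURRENCY** (lens-3 / lens-4 columns: shade `s_t`, boundary mass `m_t = |r_t|`, `o_t = s_t + m_t` by
`BoundaryLedger.order_eq_shade_add_degree`): `s_t + m_t ≤ 2q − 2` at EVERY stage of every forced walk from a root — a universal
MASS WINDOW `m_t ≤ 2q − 2 − s_t`, one unit below `FloorCut.high_mass_window` (`s + m_t ≤ 2q − 1`). [new] [folklore] -/
theorem _root_.Summit.ResolutionOfSingularities.ResolutionOfSingularities.Theorems.TightDefectClasses.ForcedWalk.shade_add_degree_le
    (hq : 2 ≤ q) (hroot : IsRoot q s₀) (W : ForcedWalk q s₀) (t : ℕ) :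
    ∃ s : ℕ, (W.st t).shade = (s : ℕ∞) ∧ s + (W.st t).r.degree ≤ 2 * q - 2 := by
  obtain ⟨o, ho, -, h2⟩ := W.band hq hroot t
  obtain ⟨s, hs, hos⟩ := BoundaryLedger.order_eq_shade_add_degree hroot W t ho
  exact ⟨s, hs, by omega⟩

/-- **CRITICAL PLATEAUX CARRY MASS `≤ q − 2`**: at a stage of shade exactly `q` the boundary mass is `≤ q − 2` (so
`BoundaryLedger.NoLoadedCriticalPlateauxDeep` lives at `1 ≤ ρ ≤ q − 2`; for `q = 4`: `ρ ∈ {1, 2}`). [new] [folklore] -/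
theorem _root_.Summit.ResolutionOfSingularities.ResolutionOfSingularities.Theorems.TightDefectClasses.ForcedWalk.degree_le_of_shade_eq
    (hq : 2 ≤ q) (hroot : IsRoot q s₀) (W : ForcedWalk q s₀) (t : ℕ) (hs : (W.st t).shade = ((q : ℕ) : ℕ∞)) :
    (W.st t).r.degree ≤ q - 2 := by
  obtain ⟨s, hs', h⟩ := W.shade_add_degree_le hq hroot t
  rw [hs] at hs'
  have : q = s := by exact_mod_cast hs'
  omega

/-- **`q = 2`**: along every forced walk from a root of the `q = 2` model the order is CONSTANTLY `2` (the band is `{2}`).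
[new] [folklore] -/
theorem _root_.Summit.ResolutionOfSingularities.ResolutionOfSingularities.Theorems.TightDefectClasses.ForcedWalk.ordZero_eq_two
    (hroot : IsRoot 2 s₀) (W : ForcedWalk 2 s₀) (t : ℕ) : ordZero (W.st t).F = 2 := by
  obtain ⟨o, ho, h1, h2⟩ := W.band (le_refl 2) hroot t
  rw [ho]
  have : o = 2 := by omega
  subst this
  rfl

end Walk

end Summit.ResolutionOfSingularities.ResolutionOfSingularities.Theorems.BandCut
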